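import Literature.AlgebraicGeometry.Frobenioids.Prop53Sub
import HarnessLib

/-!
# Frobenioids I, Cor. 5.4 — the rigidity row `FrdI.Cor54Sub.Rigid` AS TYPED: kernel reduction
# (cell abc-iut, L1 sub-DAG W3 row C54/L08; finding F-t10g3-1, GAP-LEDGER G-L1t10-1)

Mochizuki, *The geometry of Frobenioids I: the general theory*, Kyushu J. Math. **62** (2008) 293–400,
Cor. 5.4, kurims p. 104 ll. 17–18: "Moreover, each of the composite functors of this diagram is rigid",
proof ll. 22–24: "by a similar argument applied to prove the rigidity assertion in Corollary 4.11, (i),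
(iv)" [cite: MochizukiFrdI2008, Cor. 5.4 p.104].  Print's composites are those of the square formed with
`Ψ : C₁ ⥲ C₂` an EQUIVALENCE.

PROOF-ONLY.  The typed row `FrdI.Cor54Sub.Rigid hΦ₁ hΦ₂ Ψistr e₁ e₂ Ψrlf` (`Prop53Sub.lean`, seat
abc-iut-w5-d137) has FREE functor binders `Ψistr : C₁^istr ⥤ C₂^istr`, `Ψrlf : C₁^rlf ⥤ C₂^rlf` tied only by
the isomorphism `Square`.  This file shows, in the kernel, that its UNIVERSAL closure (what a `…_holds`
closer would assert) cannot hold in any instance possessing an isotropic object whose image under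
`ι₂ = FrdI.Prop53Sub.iotaRlf F₂ hΦ₂ e₂` has a non-trivial class-fixing base automorphism (as in the
motivating examples, e.g. Galois automorphisms of a Galois base field in [FrdI] Ex. 6.3):

* `square_const` — the CONSTANT pair `Ψistr := const Y`, `Ψrlf := const (ι₂ Y)` satisfies `Square`;
* `iso_eq_refl_of_forall_rigid` — the universal closure forces every automorphism of every `ι₂ Y` in
  `C₂^rlf` to be trivial (given the two Div-slim antecedents and `C₁^istr` nonempty);
* `ModelFrobenioid.exists_iso_baseMap_eq` — in ANY model Frobenioid, `(1, b, 0, 0)` is an automorphism of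
  `(A, α)` for a base automorphism `b` with `b^* α = α`;
* `base_aut_eq_id_of_forall_rigid`, `not_forall_rigid_of_exists_baseAut` — the refutable consequence /
  the conditional refutation.

The dischargeable reading is the `_of` form `rigid_of (hF₂ : IsFrobenioid F₂) (he₂ : e₂ over F_{Φ₂})
[Ψistr.IsEquivalence]` (seat abc-iut-w5-d222), reducing to the rigidity of `ι₂` (the BaseDivRigidity
pattern of Cor. 4.11 (i)/(iv)).  No statement of the paper is strengthened or refuted here: the finding
concerns the quantifier shape of the typed row only.  Nothing here bears on [IUTchIII].
-/

namespace Literature.AlgebraicGeometry.Frobenioids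

open CategoryTheory Opposite

universe w v v' u u' v₁ v₁' u₁ u₁' v₂ v₂' u₂ u₂'

/-! ### Model Frobenioids: base automorphisms fixing the class lift to automorphisms `(1, b, 0, 0)` -/

namespace ModelFrobenioid

variable {D : Type u} [Category.{v} D] {Φ B : Dᵒᵖ ⥤ CommMonCat.{w}} {DivB : B ⟶ monoidGp Φ}

/-- In the model Frobenioid of `(Φ, B, Div_B)` (Thm. 5.2 (i)): for an object `(A, α)` and a base
automorphism `b : A ⥲ A` with `Φ(b)^gp(α) = α`, the data `(deg_Fr, Base, Div, u) = (1, b, 0, 0)` is an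
AUTOMORPHISM of `(A, α)` with base component `b` (its inverse is `(1, b⁻¹, 0, 0)`).
[cite: MochizukiFrdI2008, Thm. 5.2 (i) p.100] -/
theorem exists_iso_baseMap_eq (X : ModelFrobenioid Φ B DivB) (b : X.base ≅ X.base)
    (hb : pullGp Φ b.hom X.cls = X.cls) : ∃ g : X ≅ X, baseMap g.hom = b.hom := by
  have hb' : pullGp Φ b.inv X.cls = X.cls := by
    conv_lhs => rw [← hb]
    rw [← pullGp_comp, b.inv_hom_id, pullGp_id]
  -- `(1, c, 0, 0)` for `c ∈ {b, b⁻¹}`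
  let e : ∀ (c : X.base ⟶ X.base), pullGp Φ c X.cls = X.cls → (X ⟶ X) := fun c hc =>
    { degFr := 1
      base := c
      div := 1
      unit := 1
      rel := by rw [PNat.one_coe, pow_one, map_one, mul_one, map_one, mul_one, hc] }
  have comp : ∀ (c c' : X.base ⟶ X.base) (hc : pullGp Φ c X.cls = X.cls) (hc' : pullGp Φ c' X.cls = X.cls),
      c ≫ c' = 𝟙 _ → e c hc ≫ e c' hc' = 𝟙 X := by
    intro c c' hc hc' hcc'
    apply hom_ext
    · show (1 : ℕ+) * 1 = 1
      exact mul_one 1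
    · exact hcc'
    · show (Φ.map c.op).hom 1 * 1 ^ ((1 : ℕ+) : ℕ) = 1
      rw [map_one, one_pow, mul_one]
    · show (B.map c.op).hom 1 * 1 ^ ((1 : ℕ+) : ℕ) = 1
      rw [map_one, one_pow, mul_one]
  exact ⟨⟨e b.hom hb, e b.inv hb', comp _ _ hb hb' b.hom_inv_id, comp _ _ hb' hb b.inv_hom_id⟩, rfl⟩

end ModelFrobenioid

/-! ### The reduction for `FrdI.Cor54Sub.Rigid` -/

namespace FrdI.Cor54Sub

variable {D₁ : Type u₁'} [Category.{v₁'} D₁] {Φ₁ : D₁ᵒᵖ ⥤ CommMonCat.{w}}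
  {C₁ : Type u₁} [Category.{v₁} C₁] (F₁ : C₁ ⥤ ElemFrobenioid Φ₁) (hΦ₁ : PreFrobenioid.IsPerfFactorialOn Φ₁)
  {D₂ : Type u₂'} [Category.{v₂'} D₂] {Φ₂ : D₂ᵒᵖ ⥤ CommMonCat.{w}}
  {C₂ : Type u₂} [Category.{v₂} C₂] (F₂ : C₂ ⥤ ElemFrobenioid Φ₂) (hΦ₂ : PreFrobenioid.IsPerfFactorialOn Φ₂)
  (e₁ : (PreFrobenioidData.ofFunctor Φ₁ F₁).Untr ≌ PreFrobenioid.untrModel F₁)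
  (e₂ : (PreFrobenioidData.ofFunctor Φ₂ F₂).Untr ≌ PreFrobenioid.untrModel F₂)

/-- The CONSTANT pair `Ψistr := const Y`, `Ψrlf := const (ι₂ Y)` satisfies the typed `Square`: both
composites `ι₁ ⋙ const (ι₂ Y)` and `const Y ⋙ ι₂` are the constant functor at `ι₂ Y`.
[cite: MochizukiFrdI2008, Cor. 5.4 p.104] -/
theorem square_const (Y : (PreFrobenioidData.ofFunctor Φ₂ F₂).Istr) :
    Square hΦ₁ hΦ₂ ((Functor.const _).obj Y) e₁ e₂
      ((Functor.const _).obj ((FrdI.Prop53Sub.iotaRlf F₂ hΦ₂ e₂).obj Y)) :=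
  ⟨NatIso.ofComponents (fun _ => Iso.refl _) (by
    intro X X' f
    show 𝟙 _ ≫ 𝟙 _ = 𝟙 _ ≫ (FrdI.Prop53Sub.iotaRlf F₂ hΦ₂ e₂).map (𝟙 Y)
    rw [CategoryTheory.Functor.map_id])⟩

/-- **Reduction.** If the typed row `Rigid` held for ALL functor binders `Ψistr`, `Ψrlf` (what a
universal `…_holds` closer would assert), then — granted the two Div-slim antecedents and an object of
`C₁^istr` — every automorphism of every object `ι₂ Y` of `C₂^rlf` would be the identity: apply `Rigid` to
the constant pair of `square_const` and evaluate the natural automorphism "constantly `g`" of the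
constant functor `ι₁ ⋙ const (ι₂ Y)`. [cite: MochizukiFrdI2008, Cor. 5.4 p.104] -/
theorem iso_eq_refl_of_forall_rigid
    (h : ∀ (Ψistr : (PreFrobenioidData.ofFunctor Φ₁ F₁).Istr ⥤ (PreFrobenioidData.ofFunctor Φ₂ F₂).Istr)
      (Ψrlf : PreFrobenioid.rlf F₁ hΦ₁ ⥤ PreFrobenioid.rlf F₂ hΦ₂), Rigid hΦ₁ hΦ₂ Ψistr e₁ e₂ Ψrlf)
    (h₁ : (rlfData F₁ hΦ₁).IsDivSlim) (h₂ : (rlfData F₂ hΦ₂).IsDivSlim)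
    (X₀ : (PreFrobenioidData.ofFunctor Φ₁ F₁).Istr) (Y : (PreFrobenioidData.ofFunctor Φ₂ F₂).Istr)
    (g : (FrdI.Prop53Sub.iotaRlf F₂ hΦ₂ e₂).obj Y ≅ (FrdI.Prop53Sub.iotaRlf F₂ hΦ₂ e₂).obj Y) :
    g = Iso.refl _ := by
  obtain ⟨hrig, -⟩ := h _ _ h₁ h₂ (square_const F₁ hΦ₁ F₂ hΦ₂ e₁ e₂ Y)
  -- the natural automorphism of `ι₁ ⋙ const (ι₂ Y)` with all components `g`
  let α : FrdI.Prop53Sub.iotaRlf F₁ hΦ₁ e₁ ⋙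
      (Functor.const _).obj ((FrdI.Prop53Sub.iotaRlf F₂ hΦ₂ e₂).obj Y) ≅
      FrdI.Prop53Sub.iotaRlf F₁ hΦ₁ e₁ ⋙
      (Functor.const _).obj ((FrdI.Prop53Sub.iotaRlf F₂ hΦ₂ e₂).obj Y) :=
    NatIso.ofComponents (fun _ => g) (by
      intro X X' f
      show 𝟙 _ ≫ g.hom = g.hom ≫ 𝟙 _
      rw [Category.id_comp, Category.comp_id])
  have h' := congrArg (fun i => i.hom.app X₀) (hrig α)
  change g.hom = 𝟙 _ at h'
  exact Iso.ext h'

/-- **The refutable consequence.** Under the universal hypothesis of `iso_eq_refl_of_forall_rigid`, every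
base automorphism `b` of `Base(ι₂ Y)` in `D₂` fixing the class of `ι₂ Y` is the identity
(`ModelFrobenioid.exists_iso_baseMap_eq`).  In the motivating examples this fails (a Galois
automorphism `b ≠ 1` of a Galois base field fixes the class of a Frobenius-trivial object, [FrdI]
Ex. 6.3), Div-slimness (Def. 4.5 (iv)) constraining automorphisms of the functors `D_A → D`, not of
objects. [cite: MochizukiFrdI2008, Cor. 5.4 p.104] -/
theorem base_aut_eq_id_of_forall_rigid
    (h : ∀ (Ψistr : (PreFrobenioidData.ofFunctor Φ₁ F₁).Istr ⥤ (PreFrobenioidData.ofFunctor Φ₂ F₂).Istr)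
      (Ψrlf : PreFrobenioid.rlf F₁ hΦ₁ ⥤ PreFrobenioid.rlf F₂ hΦ₂), Rigid hΦ₁ hΦ₂ Ψistr e₁ e₂ Ψrlf)
    (h₁ : (rlfData F₁ hΦ₁).IsDivSlim) (h₂ : (rlfData F₂ hΦ₂).IsDivSlim)
    (X₀ : (PreFrobenioidData.ofFunctor Φ₁ F₁).Istr) (Y : (PreFrobenioidData.ofFunctor Φ₂ F₂).Istr)
    (b : ((FrdI.Prop53Sub.iotaRlf F₂ hΦ₂ e₂).obj Y).base ≅ ((FrdI.Prop53Sub.iotaRlf F₂ hΦ₂ e₂).obj Y).base)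
    (hb : pullGp _ b.hom ((FrdI.Prop53Sub.iotaRlf F₂ hΦ₂ e₂).obj Y).cls =
      ((FrdI.Prop53Sub.iotaRlf F₂ hΦ₂ e₂).obj Y).cls) :
    b.hom = 𝟙 _ := by
  obtain ⟨g, hg⟩ := ModelFrobenioid.exists_iso_baseMap_eq _ b hb
  rw [← hg, iso_eq_refl_of_forall_rigid F₁ hΦ₁ F₂ hΦ₂ e₁ e₂ h h₁ h₂ X₀ Y g]
  rfl

/-- **Conditional refutation of the universal closure of the typed row** (finding F-t10g3-1 / GAP-LEDGER
G-L1t10-1): over Div-slim realified data, as soon as `C₁^istr` is nonempty and some isotropic `Y` of `C₂`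
has a class-fixing base automorphism `b ≠ 1` of `ι₂ Y`, `Rigid` fails for SOME binders `Ψistr`, `Ψrlf`
(namely the constant pair).  The instance-level witness (THE constructions over a base with such `b`)
is left to the consumers; the dischargeable reading is the `_of` form with `Ψistr` an equivalence.
[cite: MochizukiFrdI2008, Cor. 5.4 p.104] -/
theorem not_forall_rigid_of_exists_baseAut
    (h₁ : (rlfData F₁ hΦ₁).IsDivSlim) (h₂ : (rlfData F₂ hΦ₂).IsDivSlim)
    (X₀ : (PreFrobenioidData.ofFunctor Φ₁ F₁).Istr) (Y : (PreFrobenioidData.ofFunctor Φ₂ F₂).Istr)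
    (b : ((FrdI.Prop53Sub.iotaRlf F₂ hΦ₂ e₂).obj Y).base ≅ ((FrdI.Prop53Sub.iotaRlf F₂ hΦ₂ e₂).obj Y).base)
    (hb : pullGp _ b.hom ((FrdI.Prop53Sub.iotaRlf F₂ hΦ₂ e₂).obj Y).cls =
      ((FrdI.Prop53Sub.iotaRlf F₂ hΦ₂ e₂).obj Y).cls)
    (hne : b.hom ≠ 𝟙 _) :
    ¬ ∀ (Ψistr : (PreFrobenioidData.ofFunctor Φ₁ F₁).Istr ⥤ (PreFrobenioidData.ofFunctor Φ₂ F₂).Istr)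
      (Ψrlf : PreFrobenioid.rlf F₁ hΦ₁ ⥤ PreFrobenioid.rlf F₂ hΦ₂), Rigid hΦ₁ hΦ₂ Ψistr e₁ e₂ Ψrlf :=
  fun h => hne (base_aut_eq_id_of_forall_rigid F₁ hΦ₁ F₂ hΦ₂ e₁ e₂ h h₁ h₂ X₀ Y b hb)

end FrdI.Cor54Sub

end Literature.AlgebraicGeometry.Frobenioids
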